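import Summits.KontsevichZagierPeriods.KontsevichZagierPeriods.Theorems.TerasomaMultiplicationBetaCancellationDivisorSlicingDefs
import Literature.NumberTheory.Transcendental.KZCalculusProofs
import Literature.NumberTheory.Transcendental.SemialgebraicMapsProofs

/-!
# `BetaCancellation` (stmt-KontsevichZagierPeriods-13633), line `divisor-slicing-transshipment` — stub `stub_tameForm`, auxiliary file 1: combinatorics of `MIso`

Elementary closure properties of the finite piecewise `ℚ`-semialgebraic measure isomorphisms
`MIso N σ ρ τ θ` of `…DivisorSlicingDefs`: construction from an arbitrary finite index type of
pieces, transport along equal families and along equivalences of slot types, the identity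
isomorphism, identity-piece isomorphisms, juxtaposition (disjoint union of slot families) and
coarsening of slots (merging finitely many a.e. disjoint slots into one). No analysis here.

References: M. Kontsevich, D. Zagier, *Periods* (2001), §1.2; crux NOTES c6 (F13).
-/

noncomputable section

-- `Summit.KontsevichZagierPeriods.KontsevichZagierPeriods.…` is the tree's mandated layout (single-conjunct summit).
set_option linter.dupNamespace false

namespace Summit.KontsevichZagierPeriods.KontsevichZagierPeriods.BetaCancellationDivisorSlicing

open MeasureTheory Set
open Literature.NumberTheory.Transcendental
open Literature.NumberTheory.Transcendental.KZ
open Literature.ModelTheory.ExponentialFields (IsSemialgebraic isSemialgebraic_univ)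

namespace MIso

variable {N : ℕ} {ι κ : Type*} {σ : ι → Set (Fin N → ℝ)} {ρ : ι → (Fin N → ℝ) → ℝ}
  {τ : κ → Set (Fin N → ℝ)} {θ : κ → (Fin N → ℝ) → ℝ}

/-- A union indexed by the elements of a finite type mapping to a given slot, re-indexed along
`Fintype.equivFin`. [folklore] -/
theorem iUnion_comp_equivFin {P₀ : Type*} [Fintype P₀] {α : Type*} (src : P₀ → α)
    (S : P₀ → Set (Fin N → ℝ)) (i : α) :
    (⋃ (j : Fin (Fintype.card P₀)) (_ : src ((Fintype.equivFin P₀).symm j) = i),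
        S ((Fintype.equivFin P₀).symm j)) = ⋃ (p : P₀) (_ : src p = i), S p := by
  ext z
  simp only [mem_iUnion, exists_prop]
  constructor
  · rintro ⟨j, hj, hz⟩
    exact ⟨_, hj, hz⟩
  · rintro ⟨p, hp, hz⟩
    exact ⟨Fintype.equivFin P₀ p, by simpa using hp, by simpa using hz⟩

/-- **Construction of an `MIso` from pieces indexed by an arbitrary finite type.** [folklore] -/
theorem of_fintype {P₀ : Type*} [Fintype P₀] (src : P₀ → ι) (tgt : P₀ → κ)
    (P : P₀ → Set (Fin N → ℝ)) (Ψ : P₀ → (Fin N → ℝ) → (Fin N → ℝ))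
    (Ψ' : P₀ → (Fin N → ℝ) → ((Fin N → ℝ) →L[ℝ] (Fin N → ℝ)))
    (hpiece : ∀ p, IsSemialgebraic ℚ (P p) ∧ P p ⊆ σ (src p) ∧ IsSemialgebraicMapOn ℚ (P p) (Ψ p) ∧
      Set.InjOn (Ψ p) (P p) ∧ (∀ z ∈ P p, HasFDerivWithinAt (Ψ p) (Ψ' p z) (P p) z) ∧
      Ψ p '' P p ⊆ τ (tgt p) ∧ ∀ z ∈ P p, ρ (src p) z = θ (tgt p) (Ψ p z) * |(Ψ' p z).det|)
    (hd₁ : ∀ p p', p ≠ p' → src p = src p' → volume (P p ∩ P p') = 0)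
    (hd₂ : ∀ p p', p ≠ p' → tgt p = tgt p' → volume (Ψ p '' P p ∩ Ψ p' '' P p') = 0)
    (hc₁ : ∀ i, volume (σ i \ ⋃ (p) (_ : src p = i), P p) = 0)
    (hc₂ : ∀ k, volume (τ k \ ⋃ (p) (_ : tgt p = k), Ψ p '' P p) = 0) :
    Nonempty (MIso N σ ρ τ θ) := by
  set e := (Fintype.equivFin P₀).symm with he
  refine ⟨⟨Fintype.card P₀, src ∘ e, tgt ∘ e, P ∘ e, Ψ ∘ e, Ψ' ∘ e, fun j => hpiece (e j),
    fun j j' hjj' h => hd₁ _ _ (fun h' => hjj' (e.injective h')) h,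
    fun j j' hjj' h => hd₂ _ _ (fun h' => hjj' (e.injective h')) h, fun i => ?_, fun k => ?_⟩⟩
  · simp only [Function.comp_apply]
    rw [he, iUnion_comp_equivFin src P i]
    exact hc₁ i
  · simp only [Function.comp_apply]
    rw [he, iUnion_comp_equivFin tgt (fun p => Ψ p '' P p) k]
    exact hc₂ k

/-- The pieces of an `MIso` indexed by its own finite index type give it back (eta for
`of_fintype`); used to re-package after changing the slot maps. [folklore] -/
theorem of_src_tgt (m : MIso N σ ρ τ θ) {ι' κ' : Type*} {σ' : ι' → Set (Fin N → ℝ)}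
    {ρ' : ι' → (Fin N → ℝ) → ℝ} {τ' : κ' → Set (Fin N → ℝ)} {θ' : κ' → (Fin N → ℝ) → ℝ}
    (src' : Fin m.J → ι') (tgt' : Fin m.J → κ')
    (hσ : ∀ j, σ' (src' j) = σ (m.src j)) (hρ : ∀ j, ρ' (src' j) = ρ (m.src j))
    (hτ : ∀ j, τ' (tgt' j) = τ (m.tgt j)) (hθ : ∀ j, θ' (tgt' j) = θ (m.tgt j))
    (hd₁ : ∀ j j', j ≠ j' → src' j = src' j' → m.src j = m.src j')
    (hd₂ : ∀ j j', j ≠ j' → tgt' j = tgt' j' → m.tgt j = m.tgt j')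
    (hc₁ : ∀ i', volume (σ' i' \ ⋃ (j) (_ : src' j = i'), m.P j) = 0)
    (hc₂ : ∀ k', volume (τ' k' \ ⋃ (j) (_ : tgt' j = k'), m.Ψ j '' m.P j) = 0) :
    Nonempty (MIso N σ' ρ' τ' θ') := by
  refine ⟨⟨m.J, src', tgt', m.P, m.Ψ, m.Ψ', fun j => ?_,
    fun j j' hjj' h => m.disjoint_src j j' hjj' (hd₁ j j' hjj' h),
    fun j j' hjj' h => m.disjoint_tgt j j' hjj' (hd₂ j j' hjj' h), hc₁, hc₂⟩⟩
  obtain ⟨h1, h2, h3, h4, h5, h6, h7⟩ := m.piece j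
  refine ⟨h1, (hσ j).symm ▸ h2, h3, h4, h5, (hτ j).symm ▸ h6, fun z hz => ?_⟩
  rw [hρ j, hθ j]
  exact h7 z hz

/-- **Transport of an `MIso` along equivalences of the slot types.** [folklore] -/
theorem reindex (m : MIso N σ ρ τ θ) {ι' κ' : Type*} (e : ι' ≃ ι) (f : κ' ≃ κ) :
    Nonempty (MIso N (σ ∘ e) (ρ ∘ e) (τ ∘ f) (θ ∘ f)) := by
  refine m.of_src_tgt (e.symm ∘ m.src) (f.symm ∘ m.tgt) (fun j => by simp) (fun j => by simp)
    (fun j => by simp) (fun j => by simp) (fun j j' _ h => by simpa using h)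
    (fun j j' _ h => by simpa using h) (fun i' => ?_) (fun k' => ?_)
  · have hU : (⋃ (j) (_ : (⇑e.symm ∘ m.src) j = i'), m.P j) = ⋃ (j) (_ : m.src j = e i'), m.P j := by
      ext z
      simp only [mem_iUnion, Function.comp_apply, Equiv.symm_apply_eq]
    rw [Function.comp_apply, hU]
    exact m.cover_src (e i')
  · have hU : (⋃ (j) (_ : (⇑f.symm ∘ m.tgt) j = k'), m.Ψ j '' m.P j) =
        ⋃ (j) (_ : m.tgt j = f k'), m.Ψ j '' m.P j := by
      ext z
      simp only [mem_iUnion, Function.comp_apply, Equiv.symm_apply_eq]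
    rw [Function.comp_apply, hU]
    exact m.cover_tgt (f k')

/-- **Transport of an `MIso` along equalities of the families.** [folklore] -/
theorem copy (m : MIso N σ ρ τ θ) {σ' : ι → Set (Fin N → ℝ)} {ρ' : ι → (Fin N → ℝ) → ℝ}
    {τ' : κ → Set (Fin N → ℝ)} {θ' : κ → (Fin N → ℝ) → ℝ}
    (hσ : σ' = σ) (hρ : ρ' = ρ) (hτ : τ' = τ) (hθ : θ' = θ) : Nonempty (MIso N σ' ρ' τ' θ') := by
  subst hσ hρ hτ hθ
  exact ⟨m⟩

/-- **The identity `MIso`** of a finite family of `ℚ`-semialgebraic measured sets. [folklore] -/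
theorem refl [Fintype ι] (hσ : ∀ i, IsSemialgebraic ℚ (σ i)) : Nonempty (MIso N σ ρ σ ρ) := by
  refine of_fintype id id σ (fun _ => id) (fun _ _ => ContinuousLinearMap.id ℝ _)
    (fun i => ⟨hσ i, subset_rfl, isSemialgebraicMapOn_id (hσ i), injOn_id _,
      fun z _ => (hasFDerivAt_id z).hasFDerivWithinAt, by simp, fun z _ => ?_⟩)
    (fun p p' h h' => (h h').elim) (fun p p' h h' => (h h').elim) (fun i => ?_) (fun k => ?_)
  · have : (ContinuousLinearMap.id ℝ (Fin N → ℝ)).det = 1 := by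
      rw [ContinuousLinearMap.det, ContinuousLinearMap.coe_id, LinearMap.det_id]
    simp [this]
  · simp
  · simp

/-- **An `MIso` out of identity pieces**: finitely many `ℚ`-semialgebraic pieces `P p`, each inside
its source slot and its target slot with equal densities there, pairwise a.e. disjoint within each
source slot and within each target slot, covering every slot a.e. [folklore] -/
theorem of_idPieces {P₀ : Type*} [Fintype P₀] (src : P₀ → ι) (tgt : P₀ → κ)
    (P : P₀ → Set (Fin N → ℝ))
    (hP : ∀ p, IsSemialgebraic ℚ (P p) ∧ P p ⊆ σ (src p) ∧ P p ⊆ τ (tgt p) ∧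
      EqOn (ρ (src p)) (θ (tgt p)) (P p))
    (hd₁ : ∀ p p', p ≠ p' → src p = src p' → volume (P p ∩ P p') = 0)
    (hd₂ : ∀ p p', p ≠ p' → tgt p = tgt p' → volume (P p ∩ P p') = 0)
    (hc₁ : ∀ i, volume (σ i \ ⋃ (p) (_ : src p = i), P p) = 0)
    (hc₂ : ∀ k, volume (τ k \ ⋃ (p) (_ : tgt p = k), P p) = 0) :
    Nonempty (MIso N σ ρ τ θ) := by
  have hdet : (ContinuousLinearMap.id ℝ (Fin N → ℝ)).det = 1 := by
    rw [ContinuousLinearMap.det, ContinuousLinearMap.coe_id, LinearMap.det_id]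
  refine of_fintype src tgt P (fun _ => id) (fun _ _ => ContinuousLinearMap.id ℝ _)
    (fun p => ⟨(hP p).1, (hP p).2.1, isSemialgebraicMapOn_id (hP p).1, injOn_id _,
      fun z _ => (hasFDerivAt_id z).hasFDerivWithinAt, by simpa using (hP p).2.2.1,
      fun z hz => by simpa [hdet] using (hP p).2.2.2 hz⟩)
    hd₁ (fun p p' h h' => by simpa using hd₂ p p' h h') hc₁ (fun k => by simpa using hc₂ k)

/-- **Juxtaposition** (disjoint union of the slot families) of two `MIso`s in the same dimension.
[folklore] -/
theorem sum {ι₂ κ₂ : Type*} {σ₂ : ι₂ → Set (Fin N → ℝ)} {ρ₂ : ι₂ → (Fin N → ℝ) → ℝ}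
    {τ₂ : κ₂ → Set (Fin N → ℝ)} {θ₂ : κ₂ → (Fin N → ℝ) → ℝ}
    (m₁ : MIso N σ ρ τ θ) (m₂ : MIso N σ₂ ρ₂ τ₂ θ₂) :
    Nonempty (MIso N (Sum.elim σ σ₂) (Sum.elim ρ ρ₂) (Sum.elim τ τ₂) (Sum.elim θ θ₂)) := by
  refine of_fintype (P₀ := Fin m₁.J ⊕ Fin m₂.J) (Sum.map m₁.src m₂.src) (Sum.map m₁.tgt m₂.tgt)
    (Sum.elim m₁.P m₂.P) (Sum.elim m₁.Ψ m₂.Ψ) (Sum.elim m₁.Ψ' m₂.Ψ') ?_ ?_ ?_ ?_ ?_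
  · rintro (j | j)
    · simpa using m₁.piece j
    · simpa using m₂.piece j
  · rintro (j | j) (j' | j') hjj' h
    · exact m₁.disjoint_src j j' (fun h' => hjj' (congrArg Sum.inl h')) (by simpa using h)
    · simp at h
    · simp at h
    · exact m₂.disjoint_src j j' (fun h' => hjj' (congrArg Sum.inr h')) (by simpa using h)
  · rintro (j | j) (j' | j') hjj' h
    · exact m₁.disjoint_tgt j j' (fun h' => hjj' (congrArg Sum.inl h')) (by simpa using h)
    · simp at h
    · simp at h
    · exact m₂.disjoint_tgt j j' (fun h' => hjj' (congrArg Sum.inr h')) (by simpa using h)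
  · rintro (i | i)
    · refine measure_mono_null (fun z hz => ?_) (m₁.cover_src i)
      simp only [mem_sdiff, Sum.elim_inl, mem_iUnion, exists_prop, not_exists, not_and] at hz ⊢
      exact ⟨hz.1, fun j hj => hz.2 (Sum.inl j) (by simpa using hj)⟩
    · refine measure_mono_null (fun z hz => ?_) (m₂.cover_src i)
      simp only [mem_sdiff, Sum.elim_inr, mem_iUnion, exists_prop, not_exists, not_and] at hz ⊢
      exact ⟨hz.1, fun j hj => hz.2 (Sum.inr j) (by simpa using hj)⟩
  · rintro (k | k)
    · refine measure_mono_null (fun z hz => ?_) (m₁.cover_tgt k)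
      simp only [mem_sdiff, Sum.elim_inl, mem_iUnion, exists_prop, not_exists, not_and] at hz ⊢
      exact ⟨hz.1, fun j hj => hz.2 (Sum.inl j) (by simpa using hj)⟩
    · refine measure_mono_null (fun z hz => ?_) (m₂.cover_tgt k)
      simp only [mem_sdiff, Sum.elim_inr, mem_iUnion, exists_prop, not_exists, not_and] at hz ⊢
      exact ⟨hz.1, fun j hj => hz.2 (Sum.inr j) (by simpa using hj)⟩

/-- **Coarsening the slots of an `MIso`.** If every fine source slot `σ' i'` lies in the coarse slot
`σ (g i')` with the same density there, fine slots over one coarse slot are pairwise a.e. disjoint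
and cover it a.e., and likewise for the targets, an `MIso` between the fine families is an `MIso`
between the coarse ones. [folklore] -/
theorem merge {ι' κ' : Type*} [Fintype ι'] [Fintype κ'] {σ' : ι' → Set (Fin N → ℝ)}
    {ρ' : ι' → (Fin N → ℝ) → ℝ} {τ' : κ' → Set (Fin N → ℝ)} {θ' : κ' → (Fin N → ℝ) → ℝ}
    (m : MIso N σ' ρ' τ' θ') (g : ι' → ι) (h : κ' → κ)
    (hσ : ∀ i', σ' i' ⊆ σ (g i') ∧ EqOn (ρ' i') (ρ (g i')) (σ' i'))
    (hτ : ∀ k', τ' k' ⊆ τ (h k') ∧ EqOn (θ' k') (θ (h k')) (τ' k'))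
    (hdσ : ∀ i' i'', i' ≠ i'' → g i' = g i'' → volume (σ' i' ∩ σ' i'') = 0)
    (hdτ : ∀ k' k'', k' ≠ k'' → h k' = h k'' → volume (τ' k' ∩ τ' k'') = 0)
    (hcσ : ∀ i, volume (σ i \ ⋃ (i') (_ : g i' = i), σ' i') = 0)
    (hcτ : ∀ k, volume (τ k \ ⋃ (k') (_ : h k' = k), τ' k') = 0) :
    Nonempty (MIso N σ ρ τ θ) := by
  refine of_fintype (g ∘ m.src) (h ∘ m.tgt) m.P m.Ψ m.Ψ' (fun j => ?_) ?_ ?_ ?_ ?_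
  · obtain ⟨h1, h2, h3, h4, h5, h6, h7⟩ := m.piece j
    refine ⟨h1, h2.trans (hσ _).1, h3, h4, h5, h6.trans (hτ _).1, fun z hz => ?_⟩
    rw [Function.comp_apply, Function.comp_apply, ← (hσ _).2 (h2 hz), ← (hτ _).2 (h6 ⟨z, hz, rfl⟩)]
    exact h7 z hz
  · intro j j' hjj' hg
    by_cases hs : m.src j = m.src j'
    · exact m.disjoint_src j j' hjj' hs
    · exact measure_mono_null (inter_subset_inter (m.piece j).2.1 (m.piece j').2.1) (hdσ _ _ hs hg)
  · intro j j' hjj' hh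
    by_cases hs : m.tgt j = m.tgt j'
    · exact m.disjoint_tgt j j' hjj' hs
    · exact measure_mono_null (inter_subset_inter (m.piece j).2.2.2.2.2.1
        (m.piece j').2.2.2.2.2.1) (hdτ _ _ hs hh)
  · intro i
    have hsub : σ i \ (⋃ (j) (_ : (g ∘ m.src) j = i), m.P j) ⊆
        (σ i \ ⋃ (i') (_ : g i' = i), σ' i') ∪
          ⋃ i' ∈ (Finset.univ : Finset ι'), (σ' i' \ ⋃ (j) (_ : m.src j = i'), m.P j) := by
      intro z hz
      simp only [mem_sdiff, mem_iUnion, exists_prop, not_exists, not_and, Function.comp_apply,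
        mem_union, Finset.mem_univ, true_and] at hz ⊢
      by_cases hz' : ∃ i', g i' = i ∧ z ∈ σ' i'
      · obtain ⟨i', hi', hzi'⟩ := hz'
        exact Or.inr ⟨i', hzi', fun j hj => hz.2 j (by rw [hj, hi'])⟩
      · push Not at hz'
        exact Or.inl ⟨hz.1, hz'⟩
    refine measure_mono_null hsub (measure_union_null (hcσ i) ?_)
    exact (measure_biUnion_null_iff (Finset.countable_toSet _)).mpr fun i' _ => m.cover_src i'
  · intro k
    have hsub : τ k \ (⋃ (j) (_ : (h ∘ m.tgt) j = k), m.Ψ j '' m.P j) ⊆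
        (τ k \ ⋃ (k') (_ : h k' = k), τ' k') ∪
          ⋃ k' ∈ (Finset.univ : Finset κ'), (τ' k' \ ⋃ (j) (_ : m.tgt j = k'), m.Ψ j '' m.P j) := by
      intro z hz
      simp only [mem_sdiff, mem_iUnion, exists_prop, not_exists, not_and, Function.comp_apply,
        mem_union, Finset.mem_univ, true_and] at hz ⊢
      by_cases hz' : ∃ k', h k' = k ∧ z ∈ τ' k'
      · obtain ⟨k', hk', hzk'⟩ := hz'
        exact Or.inr ⟨k', hzk', fun j hj => hz.2 j (by rw [hj, hk'])⟩
      · push Not at hz'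
        exact Or.inl ⟨hz.1, hz'⟩
    refine measure_mono_null hsub (measure_union_null (hcτ k) ?_)
    exact (measure_biUnion_null_iff (Finset.countable_toSet _)).mpr fun k' _ => m.cover_tgt k'

end MIso

/-! ### Headline -/

/-- Registered helper goal of the stub `stub_tameForm`: juxtaposition of finite piecewise measure
isomorphisms. [folklore] -/
theorem tameForm_aux_misoSum : ∀ {N : ℕ} {ι κ ι₂ κ₂ : Type} {σ : ι → Set (Fin N → ℝ)} {ρ : ι → (Fin N → ℝ) → ℝ} {τ : κ → Set (Fin N → ℝ)} {θ : κ → (Fin N → ℝ) → ℝ} {σ₂ : ι₂ → Set (Fin N → ℝ)} {ρ₂ : ι₂ → (Fin N → ℝ) → ℝ} {τ₂ : κ₂ → Set (Fin N → ℝ)} {θ₂ : κ₂ → (Fin N → ℝ) → ℝ}, MIso N σ ρ τ θ → MIso N σ₂ ρ₂ τ₂ θ₂ → Nonempty (MIso N (Sum.elim σ σ₂) (Sum.elim ρ ρ₂) (Sum.elim τ τ₂) (Sum.elim θ θ₂)) :=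
  fun m₁ m₂ => m₁.sum m₂

end Summit.KontsevichZagierPeriods.KontsevichZagierPeriods.BetaCancellationDivisorSlicing

end
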